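import Literature.NumberTheory.EllipticCurves.DeShalit1987.RayClassTower
import Literature.NumberTheory.EllipticCurves.DeShalit1987.FiniteOrderHeckeCharacterPadicAvatar
import Literature.NumberTheory.NumberFields.RayClassFieldAdicCharacter
import Literature.NumberTheory.LFunctions.RayClassCharacter
import Literature.NumberTheory.LFunctions.AbelianFrobeniusDensity
import Literature.NumberTheory.EllipticCurves.EisensteinNumbersPartialHeckeL
import HarnessLib

/-!
# de Shalit II.4.13–4.14: the `p`-adic avatar of a Grössencharacter AT THE ARTIN LIFTS —
# `ε̂(σ_𝔠) = ε(𝔠)⁻¹` (ideal character value), the dictionary between the Galois side and the ideal side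

In de Shalit's proof of II Thm. 4.14 the integral `∫ ε dμ` over `𝒢 = Gal(K(𝔣p^∞)/K)` is unfolded
((38)→(39), p. 72–73) through the values `ε(σ_𝔠)` of the `p`-adic character `ε̂` of `𝒢` attached to a
Grössencharacter `ε` of type `A₀` unramified outside `𝔣p` (II.4.13, p. 69: "any grossencharacter … may be
regarded as a `p`-adic character of `𝒢`") at the Artin symbols `σ_𝔠 = (𝔠, K(𝔣p^∞)/K)` of the integral
ideals `𝔠` prime to `𝔣p`, and `ε(σ_𝔠)` is then READ AS THE IDEAL CHARACTER VALUE `ε(𝔠)` (up to the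
normalisation of the reciprocity map).  In the tree the avatar is a rank-one framed representation `e` of
`Γ_K` with `IsPAdicAvatarOutside S ι ε e` (arithmetic Frobenius at `𝔮 ∉ S`, `𝔮 ∤ p` has characteristic
polynomial `X − ι⁻¹(ε(ϖ_𝔮))⁻¹`), the group `𝒢` is `Γ_K ⧸ DeShalit1987.rayKer K p S`, an "Artin symbol
`σ_𝔠 ∈ 𝒢`" is any `g ∈ Γ_K` whose restriction to every ray class field `K(𝔣_j)` of a family exhausting
`K(𝔣p^∞)` is `artinSymbol (galFrob K (K(𝔣_j))) 𝔠` (the shape in which the cell's two-variable measure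
carries its lifts `g_𝔠`), and the ideal character value is `idealPow K (ε.valueAtUniformizer ·) 𝔠`.
This file proves the dictionary:

* §1 ★ `IsPAdicAvatarOutside.avatarValueAt_eq_one_of_mem_rayKer` — `ε̂ = 1` on `Gal(K̄/K(𝔣p^∞))`
  (`ε̂` is a continuous multiplicative character killing the commutators and — `ε` being unramified
  there — the inertia groups at `w ∉ S`, `w ∤ p`; these generate the closed normal subgroup `rayKer`);
  `…_eq_of_forall_absRestrictNormalHom_eq` — `ε̂(g)` depends only on the restrictions of `g` to a family of
  ray class fields exhausting `K(𝔣p^∞)`.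
* §2 `IsPAdicAvatarOutside.avatarValueAt_eq_of_isArithFrobAt` — `ε̂(Frob_𝔮) = ι⁻¹(ε(ϖ_𝔮))⁻¹`;
  `absRestrictNormalHom_rayClassField_eq_galFrob` — a Frobenius of `Γ_K` at `𝔮 ∤ 𝔪` restricts to THE
  Frobenius `galFrob K (K(𝔪)) 𝔮` of the (abelian, unramified-at-`𝔮`) ray class field.
* §3 ★★ `IsPAdicAvatarOutside.avatarValueAt_eq_of_forall_absRestrictNormalHom_eq_artinSymbol` — for
  `𝔠 ≠ 0` with prime factors outside `S ∪ {w ∣ p}` and prime to every `𝔣_j`, and `g ∈ Γ_K` restricting to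
  `(𝔠, K(𝔣_j)/K)` for every `j`:  **`ε̂(g) = ι⁻¹(ε(𝔠))⁻¹`**, `ε(𝔠) = ∏_𝔮 ε(ϖ_𝔮)^{v_𝔮(𝔠)}`
  (unique factorisation of `𝔠`, peeling one Frobenius at a time, §1 on the quotient); the kernel clause is
  the hypothesis `hray : (∀ j, g|_{K(𝔣_j)} = 1) → g ∈ rayKer K p S` (the endpoint's `⋂ U_n ⊆ rayKer`);
  `…avatarValueAt_inv_eq_…` — `ε̂(g⁻¹) = ι⁻¹(ε(𝔠))` for the inverse lifts.
* §4 `DeShalit1987.mem_rayKer_of_forall_absRestrictNormalHom_eq_one_of_cofinal` — the kernel clause for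
  any family COFINAL with the powers of `rayModulus K p S` (`K` totally complex), and the resulting
  unconditional form `…_eq_artinSymbol_of_cofinal` of §3.
* §5 `idealPow_congr_of_isCoprime` and ★ `IsPAdicAvatarOutside.avatarValueAt_eq_idealPow_mul_pow_of_…` —
  the value read through a RANGE DECOMPOSITION `ε(ϖ_w) = χ̃(w)⁻¹·λ̃(w)^{−m}` off a modulus `𝔪` prime to `𝔠`
  (the shape delivered by `…KatzJZeroRange.exists_rayClassCharacter_range_decomposition`):
  **`ε̂(σ_𝔠) = ι⁻¹(χ̃(𝔠)·λ̃(𝔠)^m)`** — the factor `ê(g_𝔠) − N𝔠` of the two-variable cell sum against the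
  complex side's `N𝔠 − χ̃(𝔠)λ̃(𝔠)^m` (de Shalit (38)→(40)).

THEOREMS ONLY (no `def`, no named fact, no `sorry`, no instance).  Cell `bsd-print-cf2`, width `bsd-line-cf2-p1-w5`
g16; piece A9 of the (e)-assembly of the R3 endpoint of print leaf 24720: it evaluates the factors `χ (g c)`,
`χ ((g (a c'))⁻¹)` (`χ = ε̂`) of `…EllipticUnitsTwoVariable.integral_twoVariable_character_pow_succ(_artin)`
against the `idealPow` factors of the complex side.  Nothing is closed by this file; BSD is not proved by this.

## References
* [deShalit1987] E. de Shalit, *Iwasawa theory of elliptic curves with complex multiplication* (1987),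
  II.4.13 (p. 69), II.4.14 (38)–(39) (p. 72–73), II.4.12 Remark (i) (p. 67), II.4.16 (p. 76).
* [SerreAbelianLadic1968] J.-P. Serre, *Abelian ℓ-adic representations and elliptic curves* (1968),
  Ch. I §2.1–§2.3, Ch. II §2.7.
* [NeukirchANT1999] J. Neukirch, *Algebraic Number Theory* (1999), Ch. VI §7 Thm. (7.1), Ch. I §9 (9.5).
-/

noncomputable section

open NumberField IsDedekindDomain IsDedekindDomain.HeightOneSpectrum Field Polynomial
open scoped Classical

namespace Literature.NumberTheory.EllipticCurves

open Literature.NumberTheory.GaloisRepresentations Literature.NumberTheory.NumberFields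
open Literature.NumberTheory.LFunctions Literature.NumberTheory.LFunctions.AbelianDensity

variable {K : Type} [Field K] [NumberField K] {p : ℕ} [Fact p.Prime]
  {S : Finset (HeightOneSpectrum (𝓞 K))} {ι : PadicAlgCl p ≃+* ℂ} {ε : HeckeCharacter K}
  {e : FramedGaloisRep K (PadicAlgCl p) 1}

/-! ### §1. `ε̂` is trivial on `Gal(K̄/K(𝔣p^∞))` -/

/-- ★ **The avatar kills `Gal(K̄/K(𝔣p^∞))`.**  If `e` is an avatar of `ε` outside `S` and `ε` is
unramified at every finite `w ∉ S`, `w ∤ p`, then `ε̂(σ) = 1` for every `σ ∈ DeShalit1987.rayKer K p S`: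
`σ ↦ ε̂(σ)` is a continuous multiplicative character of `Γ_K` (so its kernel is a closed normal subgroup)
killing the commutators and the inertia groups `I_𝔓`, `𝔓 ∣ w`, `w ∉ S`, `w ∤ p` (`e` is unramified there),
i.e. the generators of `rayKer` — de Shalit II.4.13: "`ε` may be regarded as a `p`-adic character of
`𝒢 = Gal(K(𝔣p^∞)/K)`". [cite: deShalit1987, II.4.13 (p. 69), II.4.16 (p. 76)]
[cite: SerreAbelianLadic1968, Ch. II §2.7] -/
theorem IsPAdicAvatarOutside.avatarValueAt_eq_one_of_mem_rayKer (he : IsPAdicAvatarOutside S ι ε e)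
    (hunr : ∀ w : HeightOneSpectrum (𝓞 K), w ∉ S → ((p : ℕ) : 𝓞 K) ∉ w.asIdeal → ε.IsUnramifiedAt w)
    {σ : absoluteGaloisGroup K} (hσ : σ ∈ DeShalit1987.rayKer K p S) : avatarValueAt e σ = 1 := by
  set f : absoluteGaloisGroup K → ℂ_[p] := fun τ ↦ avatarValueAt e τ with hf
  have hmul : ∀ a b, f (a * b) = f a * f b := avatarValueAt_mul e
  have h1 : f 1 = 1 := avatarValueAt_one e
  set N : Subgroup (absoluteGaloisGroup K) := SubgroupTower.mulCharKer f hmul h1 with hN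
  have hmem : ∀ {τ : absoluteGaloisGroup K}, τ ∈ N ↔ f τ = 1 := fun {τ} ↦ Iff.rfl
  haveI : N.Normal := ⟨fun a ha g ↦ by
    rw [hmem] at ha ⊢
    have hg : f g * f g⁻¹ = 1 := by rw [← hmul, mul_inv_cancel, h1]
    rw [hmul, hmul, ha, mul_one, hg]⟩
  have hle : DeShalit1987.rayKer K p S ≤ N := by
    refine Subgroup.topologicalClosure_minimal _ (Subgroup.normalClosure_le_normal ?_)
      (isClosed_eq (continuous_avatarValueAt e) continuous_const)
    intro τ hτ
    rcases DeShalit1987.mem_rayGenerators_iff.mp hτ with hτ | ⟨w, hwS, hwp, 𝔓, h𝔓, hτ⟩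
    · -- commutators: `f` is multiplicative into a (commutative) field
      have hcomm : commutator (absoluteGaloisGroup K) ≤ N := by
        rw [commutator_def]
        refine Subgroup.commutator_le.mpr fun a _ b _ ↦ ?_
        rw [commutatorElement_def, hmem]
        have ha : f a⁻¹ * f a = 1 := by rw [← hmul, inv_mul_cancel, h1]
        have hb : f b⁻¹ * f b = 1 := by rw [← hmul, inv_mul_cancel, h1]
        rw [hmul, hmul, hmul]
        calc f a * f b * f a⁻¹ * f b⁻¹ = (f a⁻¹ * f a) * (f b⁻¹ * f b) := by ring
          _ = 1 := by rw [ha, hb, one_mul]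
      exact hcomm hτ
    · -- inertia at `w ∉ S`, `w ∤ p`: `e` is unramified there
      rw [SetLike.mem_coe, hmem, hf]
      have h : e τ = 1 := (he w hwS hwp (hunr w hwS hwp)).1 𝔓 h𝔓 τ hτ
      simp only [avatarValueAt, h, map_one, Units.val_one]
      exact UniformSpace.Completion.coe_one _
  exact hmem.mp (hle hσ)

/-- **`ε̂(g)` only depends on the restrictions of `g` to a family of ray class fields exhausting
`K(𝔣p^∞)`**: if every `σ` restricting trivially to all `K(𝔣_j)` lies in `rayKer K p S`, then two elements
with the same restrictions to every `K(𝔣_j)` have the same avatar value. [cite: deShalit1987, II.4.13 (p. 69)] -/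
theorem IsPAdicAvatarOutside.avatarValueAt_eq_of_forall_absRestrictNormalHom_eq
    (he : IsPAdicAvatarOutside S ι ε e)
    (hunr : ∀ w : HeightOneSpectrum (𝓞 K), w ∉ S → ((p : ℕ) : 𝓞 K) ∉ w.asIdeal → ε.IsUnramifiedAt w)
    {J : Type*} {F : J → Ideal (𝓞 K)}
    (hray : ∀ σ : absoluteGaloisGroup K,
      (∀ j, absRestrictNormalHom (rayClassField K (F j)) σ = 1) → σ ∈ DeShalit1987.rayKer K p S)
    {g g' : absoluteGaloisGroup K}
    (hgg' : ∀ j, absRestrictNormalHom (rayClassField K (F j)) g = absRestrictNormalHom (rayClassField K (F j)) g') :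
    avatarValueAt e g = avatarValueAt e g' := by
  have hq : g'⁻¹ * g ∈ DeShalit1987.rayKer K p S := hray _ fun j ↦ by
    rw [map_mul, map_inv, ← hgg' j, inv_mul_cancel]
  have h := he.avatarValueAt_eq_one_of_mem_rayKer hunr hq
  have hg : g = g' * (g'⁻¹ * g) := by rw [mul_inv_cancel_left]
  rw [hg, avatarValueAt_mul, h, mul_one]

/-! ### §2. Frobenius elements: the avatar value and the restriction to a ray class field -/

/-- **`ε̂(Frob_𝔮) = ι⁻¹(ε(ϖ_𝔮))⁻¹`**: at a finite place `𝔮 ∉ S`, `𝔮 ∤ p`, where `ε` is unramified, every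
arithmetic Frobenius `σ ∈ Γ_K` at a prime `𝔔 ∣ 𝔮` has avatar value `ι⁻¹(ε(ϖ_𝔮))⁻¹` (the `1 × 1`
characteristic polynomial prescribed by `IsPAdicAvatarOutside`). [cite: SerreAbelianLadic1968, Ch. I §2.1, Ch. II §2.7]
[cite: deShalit1987, II.4.13 (p. 69)] -/
theorem IsPAdicAvatarOutside.avatarValueAt_eq_of_isArithFrobAt (he : IsPAdicAvatarOutside S ι ε e)
    {𝔮 : HeightOneSpectrum (𝓞 K)} (h𝔮S : 𝔮 ∉ S) (h𝔮p : ((p : ℕ) : 𝓞 K) ∉ 𝔮.asIdeal)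
    (hε : ε.IsUnramifiedAt 𝔮) {𝔔 : Ideal (absIntegers (𝓞 K) K)} (h𝔔 : 𝔔 ∈ 𝔮.primesAbove)
    {σ : absoluteGaloisGroup K} (hσ : IsArithFrobAt (𝓞 K) σ 𝔔) :
    avatarValueAt e σ = (((ι.symm (ε.valueAtUniformizer 𝔮))⁻¹ : PadicAlgCl p) : ℂ_[p]) := by
  have h := (FramedGaloisRep.hasFrobCharpolyAt_iff_of_rank_one e 𝔮 _).mp (he 𝔮 h𝔮S h𝔮p hε).2 𝔔 h𝔔 σ hσ
  rw [avatarValueAt, Matrix.GeneralLinearGroup.val_det_apply, Matrix.det_fin_one, h]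

/-- **A Frobenius of `Γ_K` at `𝔮 ∤ 𝔪` restricts to THE Frobenius of the ray class field `K(𝔪)`** (abelian
over `K`, unramified at `𝔮`): `σ|_{K(𝔪)} = galFrob K (K(𝔪)) 𝔮`. [cite: NeukirchANT1999, Ch. I §9 (9.5), Ch. VI §7 Thm. (7.1)] -/
theorem absRestrictNormalHom_rayClassField_eq_galFrob {𝔪 : Ideal (𝓞 K)} (h𝔪 : 𝔪 ≠ ⊥)
    {𝔮 : HeightOneSpectrum (𝓞 K)} (h𝔮 : ¬ 𝔪 ≤ 𝔮.asIdeal)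
    {𝔔 : Ideal (absIntegers (𝓞 K) K)} (h𝔔 : 𝔔 ∈ 𝔮.primesAbove) {σ : absoluteGaloisGroup K}
    (hσ : IsArithFrobAt (𝓞 K) σ 𝔔) :
    absRestrictNormalHom (rayClassField K 𝔪) σ = galFrob K (rayClassField K 𝔪) 𝔮 := by
  haveI : 𝔔.IsPrime := h𝔔.1
  exact eq_galFrob (commute_of_isAbelianGalois (rayClassField K 𝔪)) (isUnramifiedIn_rayClassField h𝔪 h𝔮)
    (comap_ringOfIntegersToIntegralClosure_mem_primesOver_of_mem_primesAbove (rayClassField K 𝔪) h𝔔)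
    (isArithFrobAt_absRestrictNormalHom (rayClassField K 𝔪) hσ)

/-! ### §3. The avatar at the Artin lifts -/

/-- ★★ **`ε̂(σ_𝔠) = ι⁻¹(ε(𝔠))⁻¹` — the avatar at an Artin lift is the inverse ideal character value.**
Let `e` be an avatar of `ε` outside `S`, `ε` unramified at every finite `w ∉ S`, `w ∤ p`; let
`(𝔣_j)_{j ∈ J}` be nonzero moduli such that whatever restricts trivially to every `K(𝔣_j)` lies in
`Gal(K̄/K(𝔣p^∞)) = rayKer K p S`; let `𝔠 ≠ 0` be an integral ideal prime to every `𝔣_j` all of whose prime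
factors lie outside `S ∪ {w ∣ p}`; and let `g ∈ Γ_K` restrict to the Artin symbol `(𝔠, K(𝔣_j)/K)` for every
`j`.  Then `ε̂(g) = ι⁻¹(∏_𝔮 ε(ϖ_𝔮)^{v_𝔮(𝔠)})⁻¹ = ι⁻¹(ε(𝔠))⁻¹`.  (Unique factorisation of `𝔠`: for
`𝔠 = 𝔮·𝔞` pick an arithmetic Frobenius `φ` at a prime above `𝔮`; `φ` restricts to `(𝔮, K(𝔣_j)/K)` (§2), so
`φ⁻¹g` is an Artin lift of `𝔞`, and `ε̂(g) = ε̂(φ)·ε̂(φ⁻¹g)`; for `𝔠 = 1`, `g ∈ rayKer` and §1.)  This is the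
step (38)→(39) of de Shalit's proof of II.4.14 ("`ε(σ_𝔠)`" read as the Grössencharacter value at `𝔠`).
[cite: deShalit1987, II.4.14 (38)–(39) (p. 72–73), II.4.13 (p. 69)] [cite: NeukirchANT1999, Ch. VI §7 Thm. (7.1)] -/
theorem IsPAdicAvatarOutside.avatarValueAt_eq_of_forall_absRestrictNormalHom_eq_artinSymbol
    (he : IsPAdicAvatarOutside S ι ε e)
    (hunr : ∀ w : HeightOneSpectrum (𝓞 K), w ∉ S → ((p : ℕ) : 𝓞 K) ∉ w.asIdeal → ε.IsUnramifiedAt w)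
    {J : Type*} {F : J → Ideal (𝓞 K)} (hF0 : ∀ j, F j ≠ ⊥)
    (hray : ∀ σ : absoluteGaloisGroup K,
      (∀ j, absRestrictNormalHom (rayClassField K (F j)) σ = 1) → σ ∈ DeShalit1987.rayKer K p S)
    {𝔠 : Ideal (𝓞 K)} (h𝔠 : 𝔠 ≠ ⊥)
    (h𝔠S : ∀ w : HeightOneSpectrum (𝓞 K), 𝔠 ≤ w.asIdeal → w ∉ S ∧ ((p : ℕ) : 𝓞 K) ∉ w.asIdeal)
    (h𝔠F : ∀ j, IsCoprime 𝔠 (F j))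
    {g : absoluteGaloisGroup K}
    (hg : ∀ j, absRestrictNormalHom (rayClassField K (F j)) g =
      artinSymbol (galFrob K (rayClassField K (F j))) 𝔠) :
    avatarValueAt e g =
      (((ι.symm (idealPow K (fun w ↦ ε.valueAtUniformizer w) 𝔠))⁻¹ : PadicAlgCl p) : ℂ_[p]) := by
  induction 𝔠 using UniqueFactorizationMonoid.induction_on_prime generalizing g with
  | h₁ => exact absurd Submodule.zero_eq_bot h𝔠
  | h₂ I hu =>
    obtain rfl : I = ⊤ := Ideal.isUnit_iff.mp hu
    -- `g` restricts trivially everywhere, so lies in `rayKer`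
    have htop : ∀ j, artinSymbol (galFrob K (rayClassField K (F j))) (⊤ : Ideal (𝓞 K)) = 1 :=
      fun j ↦ by
        simpa only [Finsupp.prod_zero_index, Ideal.one_eq_top] using
          artinSymbol_finsuppProd (galFrob K (rayClassField K (F j))) 0
    have hg1 : avatarValueAt e g = 1 :=
      he.avatarValueAt_eq_one_of_mem_rayKer hunr (hray g fun j ↦ by rw [hg j, htop j])
    rw [hg1, idealPow_top, map_one, inv_one]
    exact (UniformSpace.Completion.coe_one _).symm
  | h₃ 𝔞 P h𝔞0 hP ih =>
    have hP0 : P ≠ ⊥ := hP.ne_zero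
    have hPp : P.IsPrime := Ideal.isPrime_of_prime hP
    set v : HeightOneSpectrum (𝓞 K) := ⟨P, hPp, hP0⟩ with hvdef
    have hPv : P = v.asIdeal := rfl
    -- the prime `v ∣ 𝔠`: outside `S`, away from `p`, unramified for `ε`, prime to every `𝔣_j`
    obtain ⟨hvS, hvp⟩ := h𝔠S v (hPv ▸ Ideal.mul_le_right)
    have hεv : ε.IsUnramifiedAt v := hunr v hvS hvp
    have hvF : ∀ j, ¬ F j ≤ v.asIdeal := fun j hle ↦
      (isCoprime_iff_forall_not_le (hF0 j)).mp (IsCoprime.of_mul_left_left (h𝔠F j)) v hle (le_of_eq hPv)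
    -- a Frobenius `φ ∈ Γ_K` at a prime above `v`
    obtain ⟨𝔔, h𝔔⟩ := primesAbove_nonempty v
    obtain ⟨φ, hφ⟩ := HeightOneSpectrum.exists_isArithFrobAt_of_mem_primesAbove_holds (v := v) h𝔔
    have hφv : avatarValueAt e φ = (((ι.symm (ε.valueAtUniformizer v))⁻¹ : PadicAlgCl p) : ℂ_[p]) :=
      he.avatarValueAt_eq_of_isArithFrobAt hvS hvp hεv h𝔔 hφ
    have hφres : ∀ j, absRestrictNormalHom (rayClassField K (F j)) φ = galFrob K (rayClassField K (F j)) v :=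
      fun j ↦ absRestrictNormalHom_rayClassField_eq_galFrob (hF0 j) (hvF j) h𝔔 hφ
    -- `φ⁻¹ g` is an Artin lift of `𝔞`
    have hg' : ∀ j, absRestrictNormalHom (rayClassField K (F j)) (φ⁻¹ * g) =
        artinSymbol (galFrob K (rayClassField K (F j))) 𝔞 := fun j ↦ by
      have h1 : artinSymbol (galFrob K (rayClassField K (F j))) P = galFrob K (rayClassField K (F j)) v :=
        artinSymbol_asIdeal _ v
      rw [map_mul, map_inv, hg j, hφres j, artinSymbol_mul _ hP0 h𝔞0, h1, inv_mul_cancel_left]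
    have h𝔞S : ∀ w : HeightOneSpectrum (𝓞 K), 𝔞 ≤ w.asIdeal → w ∉ S ∧ ((p : ℕ) : 𝓞 K) ∉ w.asIdeal :=
      fun w hw ↦ h𝔠S w (Ideal.mul_le_left.trans hw)
    have h𝔞F : ∀ j, IsCoprime 𝔞 (F j) := fun j ↦ IsCoprime.of_mul_left_right (h𝔠F j)
    have hih := ih h𝔞0 h𝔞S h𝔞F hg'
    -- assemble
    have hgφ : g = φ * (φ⁻¹ * g) := by rw [mul_inv_cancel_left]
    rw [hgφ, avatarValueAt_mul, hφv, hih, idealPow_mul _ hP0 h𝔞0, hPv, idealPow_asIdeal, map_mul, mul_inv,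
      UniformSpace.Completion.coe_mul]

/-- **The inverse lift: `ε̂(σ_𝔠⁻¹) = ι⁻¹(ε(𝔠))`** (the terms `ε̂(g_𝔞⁻¹)` of the two-variable cell sum, where the
section of `Γ_K/Gal(K̄/K(𝔣))` is taken through the inverses of the Artin lifts). [cite: deShalit1987, II.4.14 (38)–(39) (p. 72–73)] -/
theorem IsPAdicAvatarOutside.avatarValueAt_inv_eq_of_forall_absRestrictNormalHom_eq_artinSymbol
    (he : IsPAdicAvatarOutside S ι ε e)
    (hunr : ∀ w : HeightOneSpectrum (𝓞 K), w ∉ S → ((p : ℕ) : 𝓞 K) ∉ w.asIdeal → ε.IsUnramifiedAt w)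
    {J : Type*} {F : J → Ideal (𝓞 K)} (hF0 : ∀ j, F j ≠ ⊥)
    (hray : ∀ σ : absoluteGaloisGroup K,
      (∀ j, absRestrictNormalHom (rayClassField K (F j)) σ = 1) → σ ∈ DeShalit1987.rayKer K p S)
    {𝔠 : Ideal (𝓞 K)} (h𝔠 : 𝔠 ≠ ⊥)
    (h𝔠S : ∀ w : HeightOneSpectrum (𝓞 K), 𝔠 ≤ w.asIdeal → w ∉ S ∧ ((p : ℕ) : 𝓞 K) ∉ w.asIdeal)
    (h𝔠F : ∀ j, IsCoprime 𝔠 (F j))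
    {g : absoluteGaloisGroup K}
    (hg : ∀ j, absRestrictNormalHom (rayClassField K (F j)) g =
      artinSymbol (galFrob K (rayClassField K (F j))) 𝔠) :
    avatarValueAt e g⁻¹ =
      ((ι.symm (idealPow K (fun w ↦ ε.valueAtUniformizer w) 𝔠) : PadicAlgCl p) : ℂ_[p]) := by
  have h := he.avatarValueAt_eq_of_forall_absRestrictNormalHom_eq_artinSymbol hunr hF0 hray h𝔠 h𝔠S h𝔠F hg
  rw [eq_inv_of_mul_eq_one_left (avatarValueAt_inv_mul e g), h, ← UniformSpace.Completion.coe_inv, inv_inv]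

/-! ### §4. The kernel clause for a family cofinal with `K(𝔣p^∞)`, and the unconditional dictionary -/

/-- **Whatever restricts trivially to a family of ray class fields COFINAL with `K(𝔣p^∞)` lies in
`Gal(K̄/K(𝔣p^∞))`** (`K` totally complex): if for every `m ≥ 1` some `𝔣_j ⊆ 𝔪_S^m`
(`𝔪_S = rayModulus K p S = (p)·∏_{w∈S} w`), then `K(𝔪_S^m) ⊆ K(𝔣_j)`, so `σ|_{K(𝔣_j)} = 1` for all `j`
forces `σ|_{K(𝔪_S^m)} = 1` for all `m`, i.e. `σ ∈ rayKer K p S`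
(`DeShalit1987.mem_rayKer_of_forall_absRestrictNormalHom_rayClassField_eq_one`).
[cite: deShalit1987, II.4.12 Remark (i) (p. 67), II.4.16 (p. 76)] [cite: NeukirchANT1999, Ch. VI §6 Def. (6.2)] -/
theorem DeShalit1987.mem_rayKer_of_forall_absRestrictNormalHom_eq_one_of_cofinal [IsTotallyComplex K]
    {J : Type*} {F : J → Ideal (𝓞 K)} (hF0 : ∀ j, F j ≠ ⊥)
    (hcof : ∀ m : ℕ, 0 < m → ∃ j, F j ≤ DeShalit1987.rayModulus K p S ^ m)
    {σ : absoluteGaloisGroup K} (hσ : ∀ j, absRestrictNormalHom (rayClassField K (F j)) σ = 1) :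
    σ ∈ DeShalit1987.rayKer K p S := by
  refine DeShalit1987.mem_rayKer_of_forall_absRestrictNormalHom_rayClassField_eq_one p S fun m hm ↦ ?_
  obtain ⟨j, hj⟩ := hcof m hm
  have hW : rayUnitIdeles K (F j) ≤ rayUnitIdeles K (DeShalit1987.rayModulus K p S ^ m) := by
    intro x hx
    rw [mem_rayUnitIdeles_iff] at hx ⊢
    intro w
    refine ⟨(hx w).1, (hx w).2.trans ?_⟩
    rw [WithZero.exp_le_exp, neg_le_neg_iff]
    exact FractionalIdeal.count_mono K w (FractionalIdeal.coeIdeal_ne_zero.2 (hF0 j)) (FractionalIdeal.coeIdeal_le_coeIdeal K |>.mpr hj)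
  have hle : rayClassField K (DeShalit1987.rayModulus K p S ^ m) ≤ rayClassField K (F j) := rayClassField_mono hW
  rw [← MonoidHom.mem_ker]
  exact ker_absRestrictNormalHom_anti_of_le hle (by rw [MonoidHom.mem_ker]; exact hσ j)

/-- ★★ **The dictionary, unconditional form** (`K` totally complex, e.g. imaginary quadratic): for a family of
nonzero moduli `(𝔣_j)` cofinal with the powers of `𝔪_S` — e.g. the cell's `𝔤^{m+1} v̄^{m+1} v^{k+1}`,
`𝔤 = ∏_{w∈S} w`, at a split `p = v v̄` — an avatar `e` of `ε` outside `S` (`ε` unramified off `S ∪ {w ∣ p}`),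
an ideal `𝔠 ≠ 0` prime to every `𝔣_j` with prime factors outside `S ∪ {w ∣ p}`, and `g ∈ Γ_K` with
`g|_{K(𝔣_j)} = (𝔠, K(𝔣_j)/K)` for all `j`:  **`ε̂(g) = ι⁻¹(ε(𝔠))⁻¹`**.
[cite: deShalit1987, II.4.14 (38)–(39) (p. 72–73), II.4.13 (p. 69)] [cite: NeukirchANT1999, Ch. VI §7 Thm. (7.1)] -/
theorem IsPAdicAvatarOutside.avatarValueAt_eq_of_forall_absRestrictNormalHom_eq_artinSymbol_of_cofinal
    [IsTotallyComplex K] (he : IsPAdicAvatarOutside S ι ε e)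
    (hunr : ∀ w : HeightOneSpectrum (𝓞 K), w ∉ S → ((p : ℕ) : 𝓞 K) ∉ w.asIdeal → ε.IsUnramifiedAt w)
    {J : Type*} {F : J → Ideal (𝓞 K)} (hF0 : ∀ j, F j ≠ ⊥)
    (hcof : ∀ m : ℕ, 0 < m → ∃ j, F j ≤ DeShalit1987.rayModulus K p S ^ m)
    {𝔠 : Ideal (𝓞 K)} (h𝔠 : 𝔠 ≠ ⊥)
    (h𝔠S : ∀ w : HeightOneSpectrum (𝓞 K), 𝔠 ≤ w.asIdeal → w ∉ S ∧ ((p : ℕ) : 𝓞 K) ∉ w.asIdeal)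
    (h𝔠F : ∀ j, IsCoprime 𝔠 (F j))
    {g : absoluteGaloisGroup K}
    (hg : ∀ j, absRestrictNormalHom (rayClassField K (F j)) g =
      artinSymbol (galFrob K (rayClassField K (F j))) 𝔠) :
    avatarValueAt e g =
      (((ι.symm (idealPow K (fun w ↦ ε.valueAtUniformizer w) 𝔠))⁻¹ : PadicAlgCl p) : ℂ_[p]) :=
  he.avatarValueAt_eq_of_forall_absRestrictNormalHom_eq_artinSymbol hunr hF0
    (fun _ hσ ↦ DeShalit1987.mem_rayKer_of_forall_absRestrictNormalHom_eq_one_of_cofinal hF0 hcof hσ)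
    h𝔠 h𝔠S h𝔠F hg

/-! ### §5. Reading `ε(𝔠)` through a range decomposition `ε = χ⁻¹·λ^{−m}` off `𝔪` -/

/-- Two data on primes agreeing off a modulus `𝔪` take the same value on every nonzero ideal prime to
`𝔪` (its prime factors do not divide `𝔪`). [cite: NeukirchANT1999, Ch. VII §6 Def. (6.8)] -/
theorem idealPow_congr_of_isCoprime {ψ ψ' : HeightOneSpectrum (𝓞 K) → ℂ} {𝔪 𝔠 : Ideal (𝓞 K)}
    (h𝔪 : 𝔪 ≠ ⊥) (h𝔠 : 𝔠 ≠ ⊥) (hcop : IsCoprime 𝔠 𝔪)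
    (h : ∀ w : HeightOneSpectrum (𝓞 K), ¬ 𝔪 ≤ w.asIdeal → ψ w = ψ' w) :
    idealPow K ψ 𝔠 = idealPow K ψ' 𝔠 := by
  unfold idealPow
  refine finprod_congr fun w ↦ ?_
  by_cases hc : (Associates.mk w.asIdeal).count (Associates.mk 𝔠).factors = 0
  · rw [hc, pow_zero, pow_zero]
  · rw [h w fun h𝔪w ↦ (isCoprime_iff_forall_not_le h𝔪).mp hcop w h𝔪w
      (Ideal.le_of_dvd ((Associates.count_ne_zero_iff_dvd h𝔠 w.irreducible).mp hc))]

/-- ★ **`ε̂(σ_𝔠) = ι⁻¹(χ̃(𝔠)·λ̃(𝔠)^m)` through a range decomposition.**  In the situation of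
`avatarValueAt_eq_of_forall_absRestrictNormalHom_eq_artinSymbol`, if moreover `ε(ϖ_w) = χ̃(w)⁻¹·λ̃(w)^{−m}`
at every `w ∤ 𝔪` (`χ̃` a datum on primes — a ray class character mod `𝔪` —, `λ` a Hecke character, as
delivered by the range decomposition of a type-`(−m,0)` character) and `𝔠` is prime to `𝔪`, then
`ε̂(g) = ι⁻¹(χ̃(𝔠)·λ̃(𝔠)^m)`: the factor `ε̂(σ_𝔠) − N𝔠` of the two-variable cell sum (de Shalit (38)) IS
`−(N𝔠 − χ̃(𝔠)λ̃(𝔠)^m)` of the complex side ((40)) read through `ι`.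
[cite: deShalit1987, II.4.14 (38)–(40) (p. 72–73)] [cite: NeukirchANT1999, Ch. VII §6 Def. (6.8)] -/
theorem IsPAdicAvatarOutside.avatarValueAt_eq_idealPow_mul_pow_of_forall_absRestrictNormalHom_eq_artinSymbol
    (he : IsPAdicAvatarOutside S ι ε e)
    (hunr : ∀ w : HeightOneSpectrum (𝓞 K), w ∉ S → ((p : ℕ) : 𝓞 K) ∉ w.asIdeal → ε.IsUnramifiedAt w)
    {J : Type*} {F : J → Ideal (𝓞 K)} (hF0 : ∀ j, F j ≠ ⊥)
    (hray : ∀ σ : absoluteGaloisGroup K,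
      (∀ j, absRestrictNormalHom (rayClassField K (F j)) σ = 1) → σ ∈ DeShalit1987.rayKer K p S)
    {𝔠 : Ideal (𝓞 K)} (h𝔠 : 𝔠 ≠ ⊥)
    (h𝔠S : ∀ w : HeightOneSpectrum (𝓞 K), 𝔠 ≤ w.asIdeal → w ∉ S ∧ ((p : ℕ) : 𝓞 K) ∉ w.asIdeal)
    (h𝔠F : ∀ j, IsCoprime 𝔠 (F j))
    {g : absoluteGaloisGroup K}
    (hg : ∀ j, absRestrictNormalHom (rayClassField K (F j)) g =
      artinSymbol (galFrob K (rayClassField K (F j))) 𝔠)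
    {𝔪 : Ideal (𝓞 K)} (h𝔪 : 𝔪 ≠ ⊥) (h𝔠𝔪 : IsCoprime 𝔠 𝔪)
    {χ : HeightOneSpectrum (𝓞 K) → ℂ} {lam : HeckeCharacter K} {m : ℕ}
    (hval : ∀ w : HeightOneSpectrum (𝓞 K), ¬ 𝔪 ≤ w.asIdeal →
      ε.valueAtUniformizer w = (χ w)⁻¹ * (lam.valueAtUniformizer w ^ m)⁻¹) :
    avatarValueAt e g =
      ((ι.symm (idealPow K χ 𝔠 * idealPow K (fun w ↦ lam.valueAtUniformizer w) 𝔠 ^ m) : PadicAlgCl p) :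
        ℂ_[p]) := by
  rw [he.avatarValueAt_eq_of_forall_absRestrictNormalHom_eq_artinSymbol hunr hF0 hray h𝔠 h𝔠S h𝔠F hg,
    idealPow_congr_of_isCoprime h𝔪 h𝔠 h𝔠𝔪 hval,
    idealPow_inv_mul_pow_inv (χ := χ) (ψ := fun w ↦ lam.valueAtUniformizer w) h𝔠 m, ← mul_inv, map_inv₀,
    inv_inv]

/-- ★ **`ε̂(σ_𝔠⁻¹) = ι⁻¹(χ̃(𝔠)⁻¹·λ̃(𝔠)^{−m})` through a range decomposition** — VERBATIM the coefficient
`(idealPow K χ̃ 𝔠)⁻¹ * (idealPow K λ̃ 𝔠 ^ m)⁻¹` of the complex side's class sum (de Shalit (40)), for the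
terms `ε̂(g_𝔞⁻¹)` of the two-variable cell sum. [cite: deShalit1987, II.4.14 (38)–(40) (p. 72–73)] -/
theorem IsPAdicAvatarOutside.avatarValueAt_inv_eq_idealPow_inv_mul_pow_inv_of_forall_absRestrictNormalHom_eq_artinSymbol
    (he : IsPAdicAvatarOutside S ι ε e)
    (hunr : ∀ w : HeightOneSpectrum (𝓞 K), w ∉ S → ((p : ℕ) : 𝓞 K) ∉ w.asIdeal → ε.IsUnramifiedAt w)
    {J : Type*} {F : J → Ideal (𝓞 K)} (hF0 : ∀ j, F j ≠ ⊥)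
    (hray : ∀ σ : absoluteGaloisGroup K,
      (∀ j, absRestrictNormalHom (rayClassField K (F j)) σ = 1) → σ ∈ DeShalit1987.rayKer K p S)
    {𝔠 : Ideal (𝓞 K)} (h𝔠 : 𝔠 ≠ ⊥)
    (h𝔠S : ∀ w : HeightOneSpectrum (𝓞 K), 𝔠 ≤ w.asIdeal → w ∉ S ∧ ((p : ℕ) : 𝓞 K) ∉ w.asIdeal)
    (h𝔠F : ∀ j, IsCoprime 𝔠 (F j))
    {g : absoluteGaloisGroup K}
    (hg : ∀ j, absRestrictNormalHom (rayClassField K (F j)) g =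
      artinSymbol (galFrob K (rayClassField K (F j))) 𝔠)
    {𝔪 : Ideal (𝓞 K)} (h𝔪 : 𝔪 ≠ ⊥) (h𝔠𝔪 : IsCoprime 𝔠 𝔪)
    {χ : HeightOneSpectrum (𝓞 K) → ℂ} {lam : HeckeCharacter K} {m : ℕ}
    (hval : ∀ w : HeightOneSpectrum (𝓞 K), ¬ 𝔪 ≤ w.asIdeal →
      ε.valueAtUniformizer w = (χ w)⁻¹ * (lam.valueAtUniformizer w ^ m)⁻¹) :
    avatarValueAt e g⁻¹ =
      ((ι.symm ((idealPow K χ 𝔠)⁻¹ * (idealPow K (fun w ↦ lam.valueAtUniformizer w) 𝔠 ^ m)⁻¹) :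
        PadicAlgCl p) : ℂ_[p]) := by
  rw [he.avatarValueAt_inv_eq_of_forall_absRestrictNormalHom_eq_artinSymbol hunr hF0 hray h𝔠 h𝔠S h𝔠F hg,
    idealPow_congr_of_isCoprime h𝔪 h𝔠 h𝔠𝔪 hval,
    idealPow_inv_mul_pow_inv (χ := χ) (ψ := fun w ↦ lam.valueAtUniformizer w) h𝔠 m]

/-- The same through a range decomposition, for a family of moduli cofinal with `K(𝔣p^∞)` (`K` totally
complex) — the cell's shape: `𝔣_j` running through `𝔤^{a} v̄^{b} v^{c}`, `ε = χ̃⁻¹λ^{−m}` off `𝔪_M` from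
`exists_rayClassCharacter_range_decomposition`, `𝔠` prime to `𝔪_M·v`. [cite: deShalit1987, II.4.14 (38)–(40) (p. 72–73)] -/
theorem IsPAdicAvatarOutside.avatarValueAt_eq_idealPow_mul_pow_of_cofinal [IsTotallyComplex K]
    (he : IsPAdicAvatarOutside S ι ε e)
    (hunr : ∀ w : HeightOneSpectrum (𝓞 K), w ∉ S → ((p : ℕ) : 𝓞 K) ∉ w.asIdeal → ε.IsUnramifiedAt w)
    {J : Type*} {F : J → Ideal (𝓞 K)} (hF0 : ∀ j, F j ≠ ⊥)
    (hcof : ∀ m : ℕ, 0 < m → ∃ j, F j ≤ DeShalit1987.rayModulus K p S ^ m)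
    {𝔠 : Ideal (𝓞 K)} (h𝔠 : 𝔠 ≠ ⊥)
    (h𝔠S : ∀ w : HeightOneSpectrum (𝓞 K), 𝔠 ≤ w.asIdeal → w ∉ S ∧ ((p : ℕ) : 𝓞 K) ∉ w.asIdeal)
    (h𝔠F : ∀ j, IsCoprime 𝔠 (F j))
    {g : absoluteGaloisGroup K}
    (hg : ∀ j, absRestrictNormalHom (rayClassField K (F j)) g =
      artinSymbol (galFrob K (rayClassField K (F j))) 𝔠)
    {𝔪 : Ideal (𝓞 K)} (h𝔪 : 𝔪 ≠ ⊥) (h𝔠𝔪 : IsCoprime 𝔠 𝔪)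
    {χ : HeightOneSpectrum (𝓞 K) → ℂ} {lam : HeckeCharacter K} {m : ℕ}
    (hval : ∀ w : HeightOneSpectrum (𝓞 K), ¬ 𝔪 ≤ w.asIdeal →
      ε.valueAtUniformizer w = (χ w)⁻¹ * (lam.valueAtUniformizer w ^ m)⁻¹) :
    avatarValueAt e g =
      ((ι.symm (idealPow K χ 𝔠 * idealPow K (fun w ↦ lam.valueAtUniformizer w) 𝔠 ^ m) : PadicAlgCl p) :
        ℂ_[p]) :=
  he.avatarValueAt_eq_idealPow_mul_pow_of_forall_absRestrictNormalHom_eq_artinSymbol hunr hF0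
    (fun _ hσ ↦ DeShalit1987.mem_rayKer_of_forall_absRestrictNormalHom_eq_one_of_cofinal hF0 hcof hσ)
    h𝔠 h𝔠S h𝔠F hg h𝔪 h𝔠𝔪 hval

end Literature.NumberTheory.EllipticCurves
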